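import Summits.HodgeConjecture.HodgeConjecture.Theorems.F0P3cStCharTSWeylCartanFibre        -- ★ (E1a) generic fibre kit: `subsingleton_preimage_inter_prod`, `exists_isOpen_wFree_nhds`, `wFree_mono`
import Summits.HodgeConjecture.HodgeConjecture.Theorems.F0P3cStCharTSTubeCosetIdentity       -- ★ (J6.5) `image_conjFamily_mk_prod_smul_eq`, `quotientMeasure_image_ne_zero_ne_top`; brings ★ (J6a) `QuotientMassOpenSubgroup.quotientMeasure_image_mul_measure_eq`
import Summits.HodgeConjecture.HodgeConjecture.Theorems.F0P3cStCharTSOpenCosetCover           -- ★ (J6b) `smul_coe_eq_of_mem`, `mem_own_smul_coe` (cosets of a level basis are nested or disjoint)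
import Literature.MeasureTheory.Group.ConjugationWeylVanishing                              -- ★ radial kit: `exists_radial_prod_eq_fibreCount_conjFamily`, `locallyInjOn_conjFamily`, `polishSpace_quotient_prod_subgroup`; brings ★ `FibreCountPullback`
import Literature.MeasureTheory.Measure.TubeIdentityPiSystemReduction                       -- ★ (Q4) `isPiSystem_of_subset_or_disjoint`, `measurableSet_generateFrom_of_isOpen_of_basis`, `measure_eq_of_piSystem_of_subset`
import Summits.HodgeConjecture.HodgeConjecture.Theorems.F0P3cStCharTSWeylHypFibre           -- ★ (A1) `centralizer_eq_torusU_of_isRegularElt` (any rank); brings ★ `torusU`, `mem_torusU_iff`, ★ `IsRegularElt`, `isRegularElt_conj_iff`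
import Literature.NumberTheory.Automorphic.CMTorusRegularAEPrelims                            -- ★ `isClosed_torusU_of_t1Space` (any rank)
import Literature.NumberTheory.Automorphic.JacquetNonzeroEmbedsNormalizedInd                   -- ★ `torusU_mul_comm` (the diagonal torus is abelian, any rank)
import Literature.LinearAlgebra.Matrix.SeparableCharpolyOpen                                -- ★ `Subgroup.isOpen_setOf_charpoly_separable` (the regular locus is open)
import Literature.NumberTheory.Automorphic.GLnCongruenceSubgroups                             -- ★ `congruenceGL`, `isOpen_congruenceGL`, `isCompact_congruenceGL`, `congruenceGL_mono`
import Literature.LinearAlgebra.Matrix.UnitarySingularLocusNull                             -- ★ `isClosed_unitaryGroupOfForm`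
import HarnessLib

/-!
# F0 · P3c · ROAD «UP-TR» ∕ sub-road «JAC-LOC₂» brick (B7) «MODEL-SOCKET»: ORBIT-TUBE + MASS identities on a level basis ⇒ the LOCAL TUBE-JACOBIAN SOCKET
# `hJacLoc` — GENERIC in `(G, R, T)`, and at the diagonal torus of `U(σ, J)(K)` (Harish-Chandra 1970 Lemma 22; van Dijk 1972 §2; Rogawski 1990 §12.5 p. 182)

Cell `pub/hodgecm-mathlib`, crux H413 = `stmt-HodgeConjecture-24833` (lane `--supports … --as helper`), route HCCMUnconditional; seat LH1-p03 (g10); brick (B7) of the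
sub-road «JAC-LOC₂» (sub-dealer LH7-p02 (g8), DEAL #3 2026-09-02T18:39:41Z; memo `F0/P3c/LH7/LH7-p02/g8/h4s/ROAD-JAC-LOC2.v1.LH7p02g8.md` §3) of ROAD «UP-TR» (holder
F0P3-p02 (g23)).  THEOREMS ONLY (no definition ∕ instance ∕ notation ∕ named fact ∕ `sorry`); ★-only imports; axioms TRIO.  HONEST LABEL: count-neutral (one brick of the
in-house `hUpTr` road); closes no organ.  HC_CM is proved only modulo the 7 printed citations (2 remaining: hLiu418 = `stmt-HodgeConjecture-24832`, h413 =
`stmt-HodgeConjecture-24833`) until rung 0 closes.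

THE POINT.  The Weyl-integration files (★ (E1b) `F0P3cStCharTSWeylCartanJacobian`, ★ (H3e) `F0P3cStCharTSUpTrJacobian`, ★ (Q9) `…TubeJacobianTransportNonsplit.
tubeJacobianLocal_local_of_forall_model`) consume ONE hypothesis, the LOCAL TUBE-JACOBIAN SOCKET `hJacLoc`: every `R`-regular `t₀ ∈ T` has an open `U ∋ t₀` in `T` and a Borel
`A₀ ⊆ G ⧸ T` with `0 < μ₀(A₀) < ∞` such that `ν(Φ(A₀ × V)) = μ₀(A₀) · ∫⁻_V D dtm` for every Borel, `R`-valued, `W`-free `V ⊆ U` (`Φ(xT, t) = x t x⁻¹`, `μ₀ = ν ∕ tm` the tree's ★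
`quotientMeasure`).  At a SPLIT Cartan of a `p`-adic group the socket is computed by LEVEL-SUBGROUP BOOKKEEPING [HarishChandra1970, L. 22; vanDijk1972, §2]: for a basis of
compact open subgroups `K_n` and every small torus coset `s·T_n` (`T_n = T ∩ K_n`) an ORBIT-TUBE identity `{k (s τ) k⁻¹ : k ∈ K_n, τ ∈ T_n} = s·P` (`P` any SET) and a MASS
identity `ν(P) = D(s)·ν(K_n)`.  ★ (J6) `F0P3cStCharTSWeylHypJacobianDischarge.tubeJacobianLocal_of_orbitTube'` assembled these into `hJacLoc` on the CM carrier at `N = 3`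
(through the CM-only ★ (J1) `exists_radialMeasure_tube`); this file is the RANK-FREE, CARRIER-FREE assembler in EXACTLY the letters of ★ (H3e) §1
`F0P3cStCharTSUpTrJacobian.lintegral_cartanSet_eq_of_tubeJacobian_local`, plus its instantiation at the diagonal torus `torusU σ J` of `U(σ, J)(K)` — where the rank-2 road
«JAC-LOC₂» docks its bricks (B2)(B4)(B5)(B5-M)(B6) by shape and the (B8) terminus feeds ★ (Q9)'s `hmodel` clause.
* §0 `exists_radialMeasure_tube_eq` — the fibre-count pull-back of `ν` along `Φ` (★ `FibreCountPullback`) factorises as `μ₀ ⊗ σ` (★ `ConjugationWeylVanishing.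
  exists_radial_prod_eq_fibreCount_conjFamily`); fibres over `A × V` with `V` `W`-free are single points (★ (E1a) `subsingleton_preimage_inter_prod`), so `σ` EVALUATES EVERY TUBE:
  `ν(Φ(A × V)) = μ₀(A) · σ(V)` (generic twin of ★ (J1)).
* §1 `tubeJacobianLocal_of_orbitTube` — THE ASSEMBLER: on a level coset `C = s·T_n` inside a `W`-free regular patch the orbit + mass identities and ★ (J6a)
  `quotientMeasure_image_mul_measure_eq` read `σ(C) = ∫⁻_C D dtm` (the computation of ★ (J6.5), for a bare set `P`); the cosets of the levels inside `U₁ = t₀·T_{n₁}` are nested or disjoint (★ (J6b)) — a π-system refining every open subset of `U₁` — so `σ = D·tm` on the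
  Borel subsets of `U₁` (★ (Q4) `TubeIdentityPiSystemReduction.measure_eq_of_piSystem_of_subset`); `A₀ = π(K_{n₁})` (★ `quotientMeasure_image_ne_zero_ne_top`).
* §2 `tubeJacobianLocal_torusU_of_orbitTube` — `G := U(σ, J)(K)` (any rank, any form, `K` a `T₁` topological field), `T := torusU σ J`, `R := {IsRegularElt}`: the engine letters are
  discharged by ★ `isClosed_torusU_of_t1Space`, ★ `torusU_mul_comm`, ★ (A1) `centralizer_eq_torusU_of_isRegularElt`, ★ `isRegularElt_conj_iff`, ★ `Subgroup.isOpen_setOf_charpoly_separable`; `hW`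
  ((B4)) and `horbit` ((B5)(B5-M)(B6) on the levels (B2)) stay BY SHAPE.  §3: the principal congruence levels `K_{δ n} ∩ U′` are compact open (any rank) and antitone.

## References
* [HarishChandra1970] Harish-Chandra (notes by G. van Dijk), *Harmonic analysis on reductive p-adic groups*, LNM 162 (1970), Part V §4 Lemma 22, Lemma 42.
* [vanDijk1972] G. van Dijk, *Computation of certain induced characters of p-adic groups*, Math. Ann. 199 (1972) 229–240, §2.
* [Rogawski1990] J. D. Rogawski, *Automorphic Representations of Unitary Groups in Three Variables*, Ann. of Math. Stud. 123 (1990), §12.5 p. 182; §3.1 p. 19; §1.10 p. 9.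
* [Weil1965] A. Weil, *Sur la formule de Siegel dans la théorie des groupes classiques*, Acta Math. 113 (1965), n° 49 Lemme 22 (p. 70).
* [Kechris1995] A. S. Kechris, *Classical Descriptive Set Theory*, GTM 156 (1995), §10.A Thm. 10.1.  [Casselman1995] W. Casselman, *Introduction to the theory of admissible
  representations of p-adic reductive groups* (1995), Prop. 1.4.4.
-/

set_option autoImplicit false
-- the mandated namespace has the single-problem summit's repeated segment (`HodgeConjecture.HodgeConjecture`)
set_option linter.dupNamespace false

noncomputable section

open MeasureTheory Measure Set Filter Topology Function
open Literature.MeasureTheory.Group Literature.MeasureTheory.Measure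
open Summit.HodgeConjecture.HodgeConjecture.Cruxes.H413.F0P3cStCharTSWeylCartanFibre
open Summit.HodgeConjecture.HodgeConjecture.Cruxes.H413.F0P3cStCharTSTubeCosetIdentity
open Summit.HodgeConjecture.HodgeConjecture.Cruxes.H413.F0P3cStCharTSOpenCosetCover
open Summit.HodgeConjecture.HodgeConjecture.Cruxes.H413.F0P3cStCharTSWeylHypFibre
open Literature.NumberTheory.Automorphic Literature.NumberTheory.Automorphic.UnitaryGroup Literature.NumberTheory.Rogawski1990
open scoped ENNReal NNReal Pointwise MatrixGroups

namespace Summit.HodgeConjecture.HodgeConjecture.Cruxes.H413.F0P3cStCharTSUpTrU2JacModel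

section Generic

variable {G : Type*} [Group G] [TopologicalSpace G] [IsTopologicalGroup G] [LocallyCompactSpace G]
  [SecondCountableTopology G] [T2Space G] [MeasurableSpace G] [BorelSpace G]
  {R : Set G} (hRm : MeasurableSet R) (hRc : ∀ g x : G, x ∈ R → g * x * g⁻¹ ∈ R)
  {T : Subgroup G} (hT : IsClosed (T : Set G)) (hTc : ∀ a ∈ T, ∀ b ∈ T, a * b = b * a)
  (hRT : ∀ t : ↥T, (t : G) ∈ R → Subgroup.centralizer ({(t : G)} : Set G) = T)
  (hW : (T.subgroupOf (Subgroup.normalizer (T : Set G))).index ≠ 0)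
  (Φ : (G ⧸ T) × ↥T → G) (hΦ : ∀ (x : G) (t : ↥T), Φ (QuotientGroup.mk x, t) = x * t * x⁻¹)
  [MeasurableSpace (G ⧸ T)] [BorelSpace (G ⧸ T)]
  (ν : Measure G) [ν.IsHaarMeasure] [ν.IsMulRightInvariant]
  (tm : Measure ↥T) [tm.IsMulLeftInvariant] [IsFiniteMeasureOnCompacts tm] [tm.IsOpenPosMeasure] [tm.IsInvInvariant]

/-! ## §0 The radial measure evaluates every tube over a `W`-free `R`-patch (generic twin of ★ (J1) `exists_radialMeasure_tube`) -/

set_option maxHeartbeats 1600000 in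
-- instance-term unification for `quotientMeasure` with its σ-algebra arguments (as ★ (H3e) §1)
include hRm hRc hTc hRT hW hΦ in
/-- **THE RADIAL MEASURE EVALUATES EVERY TUBE.**  `G` locally compact second-countable Hausdorff with Haar measure `ν`; `R ⊆ G` Borel and conjugation-invariant; `T ≤ G` closed
abelian with `Z(t) = T` on `T ∩ R` and `[N(T):T] ≠ 0`; `Φ(xT, t) = x t x⁻¹`; `tm` a Haar measure on `T`, `μ₀ = ν ∕ tm`.  There is a measure `σ` on `T`, finite on compacts and
σ-finite, such that for EVERY measurable `A ⊆ G ⧸ T` and every measurable, `R`-valued, `W`-free `V ⊆ T`: **`ν(Φ(A × V)) = μ₀(A) · σ(V)`** (the fibre-count pull-back of `ν`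
factorises as `μ₀ ⊗ σ`, and the fibres of `Φ` over `A × V` are single points). [cite: HarishChandra1970, Lemma 22; Lemma 42] [cite: Weil1965, n° 49 Lemme 22 (p. 70)] -/
theorem exists_radialMeasure_tube_eq :
    ∃ σ : Measure ↥T, IsFiniteMeasureOnCompacts σ ∧ SigmaFinite σ ∧
      ∀ A : Set (G ⧸ T), MeasurableSet A → ∀ V : Set ↥T, MeasurableSet V → (∀ t ∈ V, (t : G) ∈ R) →
        (∀ n : G, n ∉ T → ∀ t ∈ V, ∀ t' ∈ V, ((t' : ↥T) : G) ≠ n * t * n⁻¹) →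
          ν (Φ '' (A ×ˢ V)) = (quotientMeasure T tm hT ν) A * σ V := by
  classical
  haveI : IsClosed (T : Set G) := hT
  haveI : PolishSpace ((G ⧸ T) × ↥T) := polishSpace_quotient_prod_subgroup T hT
  have hΦc : Continuous Φ := (continuous_conjFamily_and_smul T Φ hΦ).1
  haveI : SecondCountableTopology ↥T := TopologicalSpace.Subtype.secondCountableTopology _
  haveI : BorelSpace ((G ⧸ T) × ↥T) := Prod.borelSpace
  haveI : T1Space (G ⧸ T) := QuotientGroup.instT1Space
  haveI : MeasurableSingletonClass (G ⧸ T) := ⟨fun x => isClosed_singleton.measurableSet⟩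
  haveI : MeasurableSingletonClass ↥T := ⟨fun x => isClosed_singleton.measurableSet⟩
  haveI : MeasurableSingletonClass ((G ⧸ T) × ↥T) := Prod.instMeasurableSingletonClass
  haveI : SecondCountableTopology (G ⧸ T) := (QuotientGroup.isQuotientMap_mk _).secondCountableTopology QuotientGroup.isOpenMap_coe
  haveI : LocallyCompactSpace (G ⧸ T) := QuotientGroup.instLocallyCompactSpace _
  haveI : SigmaCompactSpace (G ⧸ T) := sigmaCompactSpace_of_locallyCompact_secondCountable
  haveI : SigmaFinite (quotientMeasure T tm hT ν) := SigmaFinite.of_isFiniteMeasureOnCompacts _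
  have hDm : MeasurableSet {p : (G ⧸ T) × ↥T | ((p.2 : ↥T) : G) ∈ R} :=
    hRm.preimage (continuous_subtype_val.measurable.comp measurable_snd)
  have hinj := locallyInjOn_conjFamily T hT hTc Φ hΦ R hRT hW
  -- the fibre-count pull-back `μ` of `ν` and its Weil factorisation `μ = μ₀ ⊗ σ`
  obtain ⟨μ, hμ⟩ := exists_measure_apply_eq_lintegral_count_fibre hDm hΦc hinj ν
  obtain ⟨σ, hσfin, hσsf, -, hprod⟩ := exists_radial_prod_eq_fibreCount_conjFamily T hT hTc ν Φ hΦ R hRm hRT hRc hW tm hμ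
  haveI := hσsf
  refine ⟨σ, hσfin, hσsf, fun A₀ hA₀m V hVm hVreg hVfree => ?_⟩
  have hE : MeasurableSet (A₀ ×ˢ V) := hA₀m.prod hVm
  have hEsub : A₀ ×ˢ V ⊆ {p : (G ⧸ T) × ↥T | ((p.2 : ↥T) : G) ∈ R} := fun p hp => hVreg p.2 hp.2
  have hEim : MeasurableSet (Φ '' (A₀ ×ˢ V)) := by
    rw [← inter_eq_left.2 hEsub]; exact measurableSet_image_inter_of_locallyInjOn hDm hΦc hinj hE
  -- every fibre meets `A₀ × V` at most once (★ (E1a))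
  have hsub : ∀ y, (Φ ⁻¹' {y} ∩ (A₀ ×ˢ V ∩ {p : (G ⧸ T) × ↥T | ((p.2 : ↥T) : G) ∈ R})).Subsingleton :=
    fun y => (subsingleton_preimage_inter_prod T hTc Φ hΦ hVfree A₀ y).anti (inter_subset_inter_right _ inter_subset_left)
  have hcount : ∀ y, Measure.count (Φ ⁻¹' {y} ∩ (A₀ ×ˢ V ∩ {p : (G ⧸ T) × ↥T | ((p.2 : ↥T) : G) ∈ R})) = (Φ '' (A₀ ×ˢ V)).indicator 1 y := by
    intro y
    by_cases hy : y ∈ Φ '' (A₀ ×ˢ V)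
    · obtain ⟨p, hp, rfl⟩ := hy
      have hmem : p ∈ Φ ⁻¹' {Φ p} ∩ (A₀ ×ˢ V ∩ {p : (G ⧸ T) × ↥T | ((p.2 : ↥T) : G) ∈ R}) := ⟨rfl, hp, hEsub hp⟩
      rw [(hsub (Φ p)).eq_singleton_of_mem hmem, Measure.count_singleton, indicator_of_mem (mem_image_of_mem Φ hp), Pi.one_apply]
    · have hempty : Φ ⁻¹' {y} ∩ (A₀ ×ˢ V ∩ {p : (G ⧸ T) × ↥T | ((p.2 : ↥T) : G) ∈ R}) = ∅ :=
        eq_empty_of_forall_notMem fun p hp => hy ⟨p, hp.2.1, hp.1⟩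
      rw [hempty, measure_empty, indicator_of_notMem hy]
  have hμE : μ (A₀ ×ˢ V) = ν (Φ '' (A₀ ×ˢ V)) := by
    rw [hμ _ hE, lintegral_congr fun y => hcount y, lintegral_indicator_one hEim]
  rw [← hμE, ← hprod, Measure.prod_prod]

/-! ## §1 THE ASSEMBLER: orbit-tube + mass identities on a level basis ⇒ `hJacLoc` -/

set_option maxHeartbeats 3200000 in
-- instance-term unification for `quotientMeasure` with its σ-algebra arguments (as ★ (J6) ∕ ★ (H3e) §1)
include hRm hRc hTc hRT hW hΦ in
/-- **(B7) ORBIT-TUBE + MASS ON A LEVEL BASIS ⇒ THE LOCAL TUBE-JACOBIAN SOCKET `hJacLoc` (generic).**  Letters as in ★ (H3e) §1 (`R` Borel, OPEN, conjugation-invariant; `T`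
closed abelian, `Z(t) = T` on `T ∩ R`, `[N(T):T] ≠ 0`; `Φ(xT,t) = x t x⁻¹`; `ν` Haar; `tm` Haar on `T`; `μ₀ = ν∕tm`; `D : T → ℝ≥0` any weight); `K : ℕ → Subgroup G` compact open
subgroups, antitone, a neighbourhood basis of `1` (the levels); `T_n := T ∩ K_n` read in `T` (`(K n).comap T.subtype`).  HYPOTHESIS `horbit`: every `t₀ ∈ T ∩ R` has an open `U ∋ t₀`
on which `D` is CONSTANT and a threshold `n₀` such that for every `n ≥ n₀` and every coset `s·T_n ⊆ U` there is a SET `P ⊆ G` (on the roads: an Iwahori-type product ∕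
abelian sandwich — no subgroup structure or measurability is asked of it) with the ORBIT-TUBE identity `{k s τ k⁻¹ : k ∈ K_n, τ ∈ K_n ∩ T} = s·P` and the MASS identity `ν(P) = D(s)·ν(K_n)`.  CONCLUSION: `hJacLoc` — VERBATIM the hypothesis of ★ (H3e) §1
`lintegral_cartanSet_eq_of_tubeJacobian_local` (and, with `R = {regular}`, the `hmodel` clause of ★ (Q9)).  Proof: module docstring §1.
[cite: HarishChandra1970, Lemma 22; Lemma 42] [cite: vanDijk1972, §2] [cite: Rogawski1990, §12.5 p. 182] [cite: Weil1965, n° 49 Lemme 22 (p. 70)] [cite: Kechris1995, §10.A Thm. 10.1] -/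
theorem tubeJacobianLocal_of_orbitTube (hRo : IsOpen R) (D : ↥T → ℝ≥0)
    (K : ℕ → Subgroup G) (hKo : ∀ n, IsOpen (K n : Set G)) (hKc : ∀ n, IsCompact (K n : Set G)) (hanti : Antitone K)
    (hbasis : ∀ W ∈ 𝓝 (1 : G), ∃ n, (K n : Set G) ⊆ W)
    (horbit : ∀ t₀ : ↥T, (t₀ : G) ∈ R →
      ∃ U : Set ↥T, IsOpen U ∧ t₀ ∈ U ∧ (∀ s ∈ U, D s = D t₀) ∧ ∃ n₀ : ℕ, ∀ n, n₀ ≤ n → ∀ s : ↥T,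
        s • (((K n).comap T.subtype : Subgroup ↥T) : Set ↥T) ⊆ U →
          ∃ P : Set G,
            {x : G | ∃ k ∈ (K n : Set G), ∃ τ ∈ (K n : Set G), τ ∈ T ∧ k * (s : G) * τ * k⁻¹ = x} = (s : G) • P ∧
            ν P = (D s : ℝ≥0∞) * ν (K n : Set G)) :
    ∀ t₀ : ↥T, (t₀ : G) ∈ R →
      ∃ U : Set ↥T, IsOpen U ∧ t₀ ∈ U ∧
        ∃ A₀ : Set (G ⧸ T), MeasurableSet A₀ ∧ (quotientMeasure T tm hT ν) A₀ ≠ 0 ∧ (quotientMeasure T tm hT ν) A₀ ≠ ∞ ∧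
          ∀ V : Set ↥T, MeasurableSet V → V ⊆ U → (∀ t ∈ V, (t : G) ∈ R) →
            (∀ n : G, n ∉ T → ∀ t ∈ V, ∀ t' ∈ V, ((t' : ↥T) : G) ≠ n * t * n⁻¹) →
              ν (Φ '' (A₀ ×ˢ V)) = (quotientMeasure T tm hT ν) A₀ * ∫⁻ t in V, (D t : ℝ≥0∞) ∂tm := by
  classical
  haveI : IsClosed (T : Set G) := hT
  haveI : SecondCountableTopology ↥T := TopologicalSpace.Subtype.secondCountableTopology _
  haveI : LocallyCompactSpace ↥T := hT.locallyCompactSpace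
  haveI : SigmaCompactSpace ↥T := sigmaCompactSpace_of_locallyCompact_secondCountable
  haveI : SigmaFinite tm := SigmaFinite.of_isFiniteMeasureOnCompacts _
  -- §a the radial measure
  obtain ⟨σ, hσfin, hσsf, htube⟩ := exists_radialMeasure_tube_eq hRm hRc hT hTc hRT hW Φ hΦ ν tm
  haveI := hσfin
  haveI := hσsf
  -- §b the torus levels `T_n = T ∩ K_n`: open in `T`, antitone, a basis of `𝓝 1`
  set TK : ℕ → Subgroup ↥T := fun n => (K n).comap T.subtype with hTK
  have hTKcoe : ∀ n, ((TK n : Subgroup ↥T) : Set ↥T) = {t : ↥T | (t : G) ∈ (K n : Set G)} := fun n => by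
    rw [hTK]; ext t; simp only [Subgroup.coe_comap, Subgroup.coe_subtype, mem_preimage, mem_setOf_eq, SetLike.mem_coe]
  have hTKo : ∀ n, IsOpen ((TK n : Subgroup ↥T) : Set ↥T) := fun n => by rw [hTKcoe]; exact (hKo n).preimage continuous_subtype_val
  have hTKanti : Antitone TK := fun a b hab t ht => by simp only [hTK, Subgroup.mem_comap] at ht ⊢; exact hanti hab ht
  have hTKbasis : ∀ W ∈ 𝓝 (1 : ↥T), ∃ n, ((TK n : Subgroup ↥T) : Set ↥T) ⊆ W := by
    intro W hW
    rw [nhds_subtype_eq_comap] at hW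
    obtain ⟨W', hW', hsub⟩ := hW
    obtain ⟨n, hn⟩ := hbasis W' (by simpa using hW')
    refine ⟨n, fun t ht => hsub ?_⟩
    rw [hTKcoe] at ht
    exact hn ht
  -- a coset of `T_n` around any of its points, inside any neighbourhood
  have hcoset_nhds : ∀ (y : ↥T) (O : Set ↥T), IsOpen O → y ∈ O → ∀ m : ℕ, ∃ n, m ≤ n ∧ y • ((TK n : Subgroup ↥T) : Set ↥T) ⊆ O := by
    intro y O hO hy m
    have hpre : (fun τ : ↥T => y * τ) ⁻¹' O ∈ 𝓝 (1 : ↥T) := by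
      have hc : Continuous (fun τ : ↥T => y * τ) := continuous_const.mul continuous_id
      refine hc.continuousAt.preimage_mem_nhds ?_
      rw [mul_one]
      exact hO.mem_nhds hy
    obtain ⟨n, hn⟩ := hTKbasis _ hpre
    refine ⟨max m n, le_max_left _ _, fun z hz => ?_⟩
    obtain ⟨τ, hτ, rfl⟩ := Set.mem_smul_set.1 hz
    exact hn (hTKanti (le_max_right m n) hτ)
  -- §c the quotient masses of the levels: `μ₀(π K_n) ∉ {0, ∞}`, `π K_n` measurable
  have hπm : ∀ n, MeasurableSet (QuotientGroup.mk '' (K n : Set G) : Set (G ⧸ T)) := fun n =>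
    ((QuotientGroup.isOpenMap_coe (N := T)) _ (hKo n)).measurableSet
  have hπ0top : ∀ n, (quotientMeasure T tm hT ν) (QuotientGroup.mk '' (K n : Set G)) ≠ 0 ∧
      (quotientMeasure T tm hT ν) (QuotientGroup.mk '' (K n : Set G)) ≠ ∞ := fun n =>
    quotientMeasure_image_ne_zero_ne_top T hT tm ν (K n) (hKo n) (hKc n)
  -- §d fix a regular point; shrink to a `W`-free, `R`-valued level coset `U₁ = t₀ • T_{n₁}` inside `horbit`'s patch
  intro t₀ ht₀
  obtain ⟨U, hUo, ht₀U, hDU, n₀, hcos⟩ := horbit t₀ ht₀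
  obtain ⟨U', hU'o, ht₀U', hfree⟩ := exists_isOpen_wFree_nhds T hTc R hRT hW t₀ ht₀
  have hSo : IsOpen {t : ↥T | (t : G) ∈ R} := hRo.preimage continuous_subtype_val
  obtain ⟨n₁, hn₁, hU₁sub⟩ := hcoset_nhds t₀ (U ∩ (U' ∩ {t : ↥T | (t : G) ∈ R})) (hUo.inter (hU'o.inter hSo)) ⟨ht₀U, ht₀U', ht₀⟩ n₀
  set U₁ : Set ↥T := t₀ • ((TK n₁ : Subgroup ↥T) : Set ↥T) with hU₁
  have hU₁o : IsOpen U₁ := (hTKo n₁).smul t₀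
  have hU₁U : U₁ ⊆ U := fun t ht => (hU₁sub ht).1
  have hU₁reg : ∀ t ∈ U₁, (t : G) ∈ R := fun t ht => (hU₁sub ht).2.2
  have hU₁free : ∀ n : G, n ∉ T → ∀ t ∈ U₁, ∀ t' ∈ U₁, ((t' : ↥T) : G) ≠ n * t * n⁻¹ :=
    wFree_mono T (U := U' ∩ {t : ↥T | (t : G) ∈ R}) (fun t ht => (hU₁sub ht).2) hfree
  -- §e on every level coset `C = s • T_n ⊆ U₁`, `n ≥ n₀`: `σ C = ∫⁻_C D dtm` (★ (J6.5) with the orbit + mass identities, `D ≡ D s` on `C`)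
  have hcosetσ : ∀ (n : ℕ), n₀ ≤ n → ∀ s : ↥T, s • ((TK n : Subgroup ↥T) : Set ↥T) ⊆ U₁ →
      σ (s • ((TK n : Subgroup ↥T) : Set ↥T)) = ∫⁻ t in s • ((TK n : Subgroup ↥T) : Set ↥T), (D t : ℝ≥0∞) ∂tm := by
    intro n hn s hCU₁
    obtain ⟨P, horb, hνP⟩ := hcos n hn s (hCU₁.trans hU₁U)
    have hCm : MeasurableSet (s • ((TK n : Subgroup ↥T) : Set ↥T)) := ((hTKo n).smul s).measurableSet
    have hsC : s ∈ s • ((TK n : Subgroup ↥T) : Set ↥T) := mem_own_smul_coe (TK n) s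
    -- ★ (J6a): `μ₀(π K_n) · tm(T_n) = ν(K_n)`
    have hmass := F0P3cStCharTSQuotientMassOpenSubgroup.quotientMeasure_image_mul_measure_eq T hT tm ν (K n) (hKo n)
    -- the tube over `π(K_n) × C` is `s • P` (orbit identity), of mass `ν P = D s · ν K_n` (mass identity); compare with `htube`
    have h1 := htube _ (hπm n) _ hCm (fun t ht => hU₁reg t (hCU₁ ht)) (wFree_mono T hCU₁ hU₁free)
    rw [hTKcoe n, image_conjFamily_mk_prod_smul_eq T Φ hΦ (K n : Set G) P s horb, measure_smul, hνP, ← hmass] at h1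
    -- `h1 : D s * (μ₀(π K_n) * tm T_n) = μ₀(π K_n) * σ C`
    have hσC : σ (s • {h : ↥T | (h : G) ∈ (K n : Set G)}) = (D s : ℝ≥0∞) * tm {t : ↥T | (t : G) ∈ (K n : Set G)} := by
      refine ((ENNReal.mul_right_inj (hπ0top n).1 (hπ0top n).2).1 ?_).symm
      rw [← h1]; ring
    -- `∫⁻_C D dtm = D s · tm C = D s · tm T_n` (`D ≡ D s` on `C ⊆ U`)
    have hDC : ∀ t ∈ s • ((TK n : Subgroup ↥T) : Set ↥T), (D t : ℝ≥0∞) = (D s : ℝ≥0∞) := fun t ht => by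
      rw [hDU t (hU₁U (hCU₁ ht)), hDU s (hU₁U (hCU₁ hsC))]
    rw [setLIntegral_congr_fun hCm hDC, setLIntegral_const, hTKcoe n, hσC, measure_smul]
  -- §f the π-system of level cosets inside `U₁`, and `σ = D · tm` on the Borel subsets of `U₁`
  set 𝒞 : Set (Set ↥T) := {C | ∃ (s : ↥T) (n : ℕ), n₁ ≤ n ∧ C = s • ((TK n : Subgroup ↥T) : Set ↥T) ∧ C ⊆ U₁} with h𝒞
  have h𝒞U : ∀ C ∈ 𝒞, C ⊆ U₁ := by rintro C ⟨s, n, -, -, hCU⟩; exact hCU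
  have h𝒞o : ∀ C ∈ 𝒞, IsOpen C := by rintro C ⟨s, n, -, rfl, -⟩; exact (hTKo n).smul s
  have h𝒞m : ∀ C ∈ 𝒞, MeasurableSet C := fun C hC => (h𝒞o C hC).measurableSet
  have hU𝒞 : U₁ ∈ 𝒞 := ⟨t₀, n₁, le_rfl, rfl, subset_rfl⟩
  have hnd : ∀ C ∈ 𝒞, ∀ C' ∈ 𝒞, C ⊆ C' ∨ C' ⊆ C ∨ Disjoint C C' := by
    rintro C ⟨s, n, -, rfl, -⟩ C' ⟨s', n', -, rfl, -⟩
    by_cases hdisj : Disjoint (s • ((TK n : Subgroup ↥T) : Set ↥T)) (s' • ((TK n' : Subgroup ↥T) : Set ↥T))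
    · exact Or.inr (Or.inr hdisj)
    obtain ⟨z, hz, hz'⟩ := Set.not_disjoint_iff.1 hdisj
    -- both cosets are cosets of `z`; the one of the finer level is inside the other
    rw [← smul_coe_eq_of_mem (TK n) hz, ← smul_coe_eq_of_mem (TK n') hz']
    rcases le_total n n' with hle | hle
    · exact Or.inr (Or.inl (Set.smul_set_mono (hTKanti hle)))
    · exact Or.inl (Set.smul_set_mono (hTKanti hle))
  have hπsys : IsPiSystem 𝒞 := isPiSystem_of_subset_or_disjoint 𝒞 hnd
  have hrefine : ∀ O : Set ↥T, IsOpen O → O ⊆ U₁ → ∀ y ∈ O, ∃ C ∈ 𝒞, y ∈ C ∧ C ⊆ O := by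
    intro O hO hOU y hy
    obtain ⟨n, hn, hsub⟩ := hcoset_nhds y O hO hy n₁
    exact ⟨y • ((TK n : Subgroup ↥T) : Set ↥T), ⟨y, n, hn, rfl, hsub.trans hOU⟩, mem_own_smul_coe (TK n) y, hsub⟩
  have hopen : ∀ O : Set ↥T, IsOpen O → O ⊆ U₁ → MeasurableSet[MeasurableSpace.generateFrom 𝒞] O :=
    fun O hO hOU => measurableSet_generateFrom_of_isOpen_of_basis 𝒞 h𝒞o hrefine hO hOU
  have heq𝒞 : ∀ C ∈ 𝒞, σ C = (tm.withDensity fun t => (D t : ℝ≥0∞)) C := by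
    rintro C ⟨s, n, hn, rfl, hCU⟩
    rw [withDensity_apply _ (((hTKo n).smul s).measurableSet)]
    exact hcosetσ n (hn₁.trans hn) s hCU
  have hσU₁ : σ U₁ ≠ ∞ := by
    rw [heq𝒞 U₁ hU𝒞, withDensity_apply _ hU₁o.measurableSet, hU₁]
    have hTKc : IsCompact ((TK n₁ : Subgroup ↥T) : Set ↥T) := by
      rw [hTKcoe]
      exact hT.isClosedEmbedding_subtypeVal.isCompact_preimage (hKc n₁)
    have hCc : IsCompact (t₀ • ((TK n₁ : Subgroup ↥T) : Set ↥T)) := hTKc.smul t₀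
    -- `∫⁻_{U₁} D = D t₀ * tm U₁ < ∞` (`D ≡ D t₀` on `U₁ ⊆ U`, `U₁` compact)
    have hint : ∫⁻ t in t₀ • ((TK n₁ : Subgroup ↥T) : Set ↥T), (D t : ℝ≥0∞) ∂tm = (D t₀ : ℝ≥0∞) * tm (t₀ • ((TK n₁ : Subgroup ↥T) : Set ↥T)) := by
      rw [setLIntegral_congr_fun hU₁o.measurableSet (fun t ht => by rw [hDU t (hU₁U ht)]), setLIntegral_const]
    rw [hint]
    exact (ENNReal.mul_lt_top ENNReal.coe_lt_top hCc.measure_lt_top).ne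
  have hσV : ∀ V : Set ↥T, MeasurableSet V → V ⊆ U₁ → σ V = ∫⁻ t in V, (D t : ℝ≥0∞) ∂tm := by
    intro V hV hVU
    rw [← withDensity_apply _ hV]
    exact measure_eq_of_piSystem_of_subset σ (tm.withDensity fun t => (D t : ℝ≥0∞)) hU₁o hσU₁ 𝒞 hπsys hU𝒞 h𝒞m h𝒞U hopen heq𝒞 hV hVU
  -- §g assembly
  refine ⟨U₁, hU₁o, mem_own_smul_coe (TK n₁) t₀, QuotientGroup.mk '' (K n₁ : Set G), hπm n₁, (hπ0top n₁).1, (hπ0top n₁).2,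
    fun V hV hVU hVreg hVfree => ?_⟩
  rw [htube _ (hπm n₁) V hV hVreg hVfree, hσV V hV hVU]

end Generic

/-! ## §2 THE MODEL SOCKET at the diagonal torus `T = torusU σ J` of `U(σ, J)(K)` (any rank `N`, any form `J`, any `T₁` topological field `K`) -/

section Model

variable {K : Type*} [Field K] (σ : K →+* K) {N : ℕ} (J : Matrix (Fin N) (Fin N) K)

/-- Regularity (`IsRegularElt`, separable characteristic polynomial) is conjugation-invariant on `U(σ, J)(K)` (★ `isRegularElt_conj_iff`). [cite: Rogawski1990, §3.1 p. 19] -/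
theorem isRegularElt_conj_coe (g x : ↥(unitaryGroupOfForm σ J)) (hx : IsRegularElt (x : GL (Fin N) K)) :
    IsRegularElt ((g * x * g⁻¹ : ↥(unitaryGroupOfForm σ J)) : GL (Fin N) K) := by
  rw [Subgroup.coe_mul, Subgroup.coe_mul, Subgroup.coe_inv]
  exact (isRegularElt_conj_iff (g : GL (Fin N) K) (x : GL (Fin N) K)).2 hx

/-- The regular locus `{g | IsRegularElt g}` of `U(σ, J)(K)` is open (★ `Subgroup.isOpen_setOf_charpoly_separable`). [cite: Rogawski1990, §3.1 p. 19] -/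
theorem isOpen_setOf_isRegularElt_unitaryGroupOfForm [TopologicalSpace K] [IsTopologicalRing K] [T1Space K] :
    IsOpen {g : ↥(unitaryGroupOfForm σ J) | IsRegularElt (g : GL (Fin N) K)} :=
  (unitaryGroupOfForm σ J).isOpen_setOf_charpoly_separable

variable [TopologicalSpace K] [IsTopologicalRing K] [T1Space K]
  [MeasurableSpace ↥(unitaryGroupOfForm σ J)] [BorelSpace ↥(unitaryGroupOfForm σ J)] [LocallyCompactSpace ↥(unitaryGroupOfForm σ J)]
  [SecondCountableTopology ↥(unitaryGroupOfForm σ J)] [T2Space ↥(unitaryGroupOfForm σ J)]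
  [MeasurableSpace (↥(unitaryGroupOfForm σ J) ⧸ torusU σ J)] [BorelSpace (↥(unitaryGroupOfForm σ J) ⧸ torusU σ J)]
  (ν : Measure ↥(unitaryGroupOfForm σ J)) [ν.IsHaarMeasure] [ν.IsMulRightInvariant]
  (tm : Measure ↥(torusU σ J)) [tm.IsMulLeftInvariant] [IsFiniteMeasureOnCompacts tm] [tm.IsOpenPosMeasure] [tm.IsInvInvariant]
  (Φ : (↥(unitaryGroupOfForm σ J) ⧸ torusU σ J) × ↥(torusU σ J) → ↥(unitaryGroupOfForm σ J))
  (hΦ : ∀ (x : ↥(unitaryGroupOfForm σ J)) (t : ↥(torusU σ J)), Φ (QuotientGroup.mk x, t) = x * t * x⁻¹)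

set_option maxHeartbeats 3200000 in
-- as §1
include hΦ in
/-- **(B7) THE MODEL SOCKET AT THE DIAGONAL TORUS OF `U(σ, J)(K)`.**  `K` a `T₁` topological field, `σ : K →+* K`, `J` any form of rank `N`, `U′ = U(σ, J)(K)` (locally compact,
second countable, Hausdorff), `T = torusU σ J` the diagonal torus, `R = {g | IsRegularElt g}`; `ν` Haar on `U′`, `tm` Haar on `T`, `μ₀ = ν∕tm`, `Φ(xT, t) = x t x⁻¹`, `D : T → ℝ≥0`
any weight; `[N(T):T] ≠ 0` (`hW`, the finite Weyl group — (B4) NORM₂ at `N = 2`); `Kl : ℕ → Subgroup U′` compact open subgroups, antitone, a neighbourhood basis of `1` (the levels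
(B2)); and `horbit` = ORBIT-TUBE + MASS on the level cosets of regular diagonal elements ((B5) ⊆, (B6) ⊇, (B5-M); `D` locally constant, (B8a)).  THEN the local tube-Jacobian
socket holds at `T` for `(ν, tm)` — the `hmodel` clause of ★ (Q9) `tubeJacobianLocal_local_of_forall_model` (there `N = 2`, `K = L_w`, `σ = σ_w`, `J = Φ₂`, `T′ = torusU = Z(e γ₀)`).
= §1 at `G := U′`, `R := {IsRegularElt}`, `T := torusU σ J` with ★ `isClosed_torusU_of_t1Space`, ★ `torusU_mul_comm`, ★ (A1) `centralizer_eq_torusU_of_isRegularElt`, ★ `isRegularElt_conj_iff`,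
★ `Subgroup.isOpen_setOf_charpoly_separable`. [cite: HarishChandra1970, Lemma 22] [cite: vanDijk1972, §2] [cite: Rogawski1990, §12.5 p. 182] -/
theorem tubeJacobianLocal_torusU_of_orbitTube
    (hW : ((torusU σ J).subgroupOf (Subgroup.normalizer (torusU σ J : Set ↥(unitaryGroupOfForm σ J)))).index ≠ 0)
    (D : ↥(torusU σ J) → ℝ≥0)
    (Kl : ℕ → Subgroup ↥(unitaryGroupOfForm σ J)) (hKo : ∀ n, IsOpen (Kl n : Set ↥(unitaryGroupOfForm σ J)))
    (hKc : ∀ n, IsCompact (Kl n : Set ↥(unitaryGroupOfForm σ J))) (hanti : Antitone Kl)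
    (hbasis : ∀ W ∈ 𝓝 (1 : ↥(unitaryGroupOfForm σ J)), ∃ n, (Kl n : Set ↥(unitaryGroupOfForm σ J)) ⊆ W)
    (horbit : ∀ t₀ : ↥(torusU σ J), IsRegularElt (((t₀ : ↥(unitaryGroupOfForm σ J))) : GL (Fin N) K) →
      ∃ U : Set ↥(torusU σ J), IsOpen U ∧ t₀ ∈ U ∧ (∀ s ∈ U, D s = D t₀) ∧ ∃ n₀ : ℕ, ∀ n, n₀ ≤ n → ∀ s : ↥(torusU σ J),
        s • (((Kl n).comap (torusU σ J).subtype : Subgroup ↥(torusU σ J)) : Set ↥(torusU σ J)) ⊆ U →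
          ∃ P : Set ↥(unitaryGroupOfForm σ J),
            {x : ↥(unitaryGroupOfForm σ J) | ∃ k ∈ (Kl n : Set ↥(unitaryGroupOfForm σ J)), ∃ τ ∈ (Kl n : Set ↥(unitaryGroupOfForm σ J)),
                τ ∈ torusU σ J ∧ k * (s : ↥(unitaryGroupOfForm σ J)) * τ * k⁻¹ = x} = ((s : ↥(unitaryGroupOfForm σ J))) • P ∧
            ν P = (D s : ℝ≥0∞) * ν (Kl n : Set ↥(unitaryGroupOfForm σ J))) :
    ∀ t₀ : ↥(torusU σ J), IsRegularElt (((t₀ : ↥(unitaryGroupOfForm σ J))) : GL (Fin N) K) →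
      ∃ U : Set ↥(torusU σ J), IsOpen U ∧ t₀ ∈ U ∧
        ∃ A₀ : Set (↥(unitaryGroupOfForm σ J) ⧸ torusU σ J), MeasurableSet A₀ ∧
          (quotientMeasure (torusU σ J) tm (isClosed_torusU_of_t1Space σ J) ν) A₀ ≠ 0 ∧
          (quotientMeasure (torusU σ J) tm (isClosed_torusU_of_t1Space σ J) ν) A₀ ≠ ∞ ∧
          ∀ V : Set ↥(torusU σ J), MeasurableSet V → V ⊆ U →
            (∀ t ∈ V, IsRegularElt (((t : ↥(unitaryGroupOfForm σ J))) : GL (Fin N) K)) →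
            (∀ n : ↥(unitaryGroupOfForm σ J), n ∉ torusU σ J → ∀ t ∈ V, ∀ t' ∈ V,
                ((t' : ↥(torusU σ J)) : ↥(unitaryGroupOfForm σ J)) ≠ n * t * n⁻¹) →
              ν (Φ '' (A₀ ×ˢ V)) = (quotientMeasure (torusU σ J) tm (isClosed_torusU_of_t1Space σ J) ν) A₀ * ∫⁻ t in V, (D t : ℝ≥0∞) ∂tm :=
  tubeJacobianLocal_of_orbitTube (R := {g : ↥(unitaryGroupOfForm σ J) | IsRegularElt (g : GL (Fin N) K)})
    (isOpen_setOf_isRegularElt_unitaryGroupOfForm σ J).measurableSet (fun g x hx => isRegularElt_conj_coe σ J g x hx)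
    (isClosed_torusU_of_t1Space σ J) (fun a ha b hb => congrArg Subtype.val (torusU_mul_comm σ J ⟨a, ha⟩ ⟨b, hb⟩))
    (fun t ht => centralizer_eq_torusU_of_isRegularElt σ J t.2 ht) hW Φ hΦ ν tm
    (isOpen_setOf_isRegularElt_unitaryGroupOfForm σ J) D Kl hKo hKc hanti hbasis horbit

end Model

/-! ## §3 Over a non-archimedean local field: the PRINCIPAL CONGRUENCE LEVELS `K_{δ n} ∩ U′` are compact open and antitone along a schedule (the (B2)∕(J2) currency) -/

section Levels

open ValuativeRel

variable {K : Type*} [Field K] [ValuativeRel K] [TopologicalSpace K] [IsNonarchimedeanLocalField K] [IsTopologicalRing K]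
  (σ : K →+* K) {N : ℕ} (J : Matrix (Fin N) (Fin N) K)

/-- The trace `K_γ ∩ U′` of a principal congruence subgroup on `U′ = U(σ, J)(K)` (`σ` continuous, `γ ≠ 0`) is compact and open — ★ `isCompact_isOpen_comap_congruenceGL` with
`3 ↦ N` (closed embedding `U′ ↪ GL_N(K)` ★ `isClosed_unitaryGroupOfForm`; ★ `isCompact_congruenceGL`, ★ `isOpen_congruenceGL`). [cite: Casselman1995, Prop. 1.4.4] -/
theorem isCompact_isOpen_level (hσc : Continuous σ) {γ : ValueGroupWithZero K} (hγ : γ ≠ 0) :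
    IsCompact (((congruenceGL N γ).comap (unitaryGroupOfForm σ J).subtype : Subgroup ↥(unitaryGroupOfForm σ J)) : Set ↥(unitaryGroupOfForm σ J)) ∧
      IsOpen (((congruenceGL N γ).comap (unitaryGroupOfForm σ J).subtype : Subgroup ↥(unitaryGroupOfForm σ J)) : Set ↥(unitaryGroupOfForm σ J)) := by
  haveI : T2Space K := (Literature.NumberTheory.GaloisRepresentations.IsNonarchimedeanLocalField.isLocalField K).toT2Space
  have hcl : IsClosed (unitaryGroupOfForm σ J : Set (GL (Fin N) K)) := isClosed_unitaryGroupOfForm (σ := σ) hσc J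
  exact ⟨hcl.isClosedEmbedding_subtypeVal.isCompact_preimage (isCompact_congruenceGL γ), (isOpen_congruenceGL hγ).preimage continuous_subtype_val⟩

omit [TopologicalSpace K] [IsNonarchimedeanLocalField K] [IsTopologicalRing K] in
/-- Along an antitone schedule `δ` the levels `n ↦ K_{δ n} ∩ U′` are antitone (★ `congruenceGL_mono`) — with `isCompact_isOpen_level` and a neighbourhood-basis schedule
(★ (J5-ARITH) pattern) these are the `(hKo) (hKc) (hanti) (hbasis)` inputs of `tubeJacobianLocal_torusU_of_orbitTube` for `Kl n := K_{δ n} ∩ U′`. [cite: Casselman1995, Prop. 1.4.4] -/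
theorem antitone_level {δ : ℕ → ValueGroupWithZero K} (hδ : Antitone δ) :
    Antitone fun n => ((congruenceGL N (δ n)).comap (unitaryGroupOfForm σ J).subtype : Subgroup ↥(unitaryGroupOfForm σ J)) :=
  fun _ _ hab => Subgroup.comap_mono (congruenceGL_mono (hδ hab))

omit [IsTopologicalRing K] in
/-- (ED. 2) **The levels `K_{δ n} ∩ U′` of a schedule with `∀ γ ≠ 0, ∃ n, δ n ≤ γ` form a neighbourhood basis of `1` in `U′ = U(σ, J)(K)`** (any rank; ★ `exists_congruenceGL_subset`
in `GL_N(K)` pulled back along the embedding) — the `hbasis` input of `tubeJacobianLocal_torusU_of_orbitTube` for `Kl n := K_{δ n} ∩ U′`. [cite: Casselman1995, Prop. 1.4.4] -/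
theorem level_basis_of_schedule {δ : ℕ → ValueGroupWithZero K} (hsmall : ∀ γ : ValueGroupWithZero K, γ ≠ 0 → ∃ n, δ n ≤ γ) : ∀ W ∈ 𝓝 (1 : ↥(unitaryGroupOfForm σ J)),
    ∃ n, (((congruenceGL N (δ n)).comap (unitaryGroupOfForm σ J).subtype : Subgroup ↥(unitaryGroupOfForm σ J)) : Set ↥(unitaryGroupOfForm σ J)) ⊆ W := by
  intro W hW
  obtain ⟨O, hO, hsub⟩ := (mem_nhds_induced Subtype.val (1 : ↥(unitaryGroupOfForm σ J)) W).1 hW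
  obtain ⟨γ, hγ⟩ := exists_congruenceGL_subset (n := N) (by rwa [OneMemClass.coe_one] at hO)
  obtain ⟨n, hn⟩ := hsmall γ γ.ne_zero
  exact ⟨n, fun y hy => hsub (hγ (congruenceGL_mono hn (Subgroup.mem_comap.1 hy)))⟩

end Levels

end Summit.HodgeConjecture.HodgeConjecture.Cruxes.H413.F0P3cStCharTSUpTrU2JacModel

end
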